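/-
Copyright (c) 2026 the pub-hodgecm-mathlib formalisation cell (harness21).  Prover seat hodgecm-mathlib-K2E4-p10 (g10), Track B «K2-LIT»,
#184♮ = hLiu418 = `stmt-HodgeConjecture-24832`; socket #41, KIND 1 — (K1a-♮) THE SINGULAR-TERM PACKAGE, the K1-a♮ twin of ★ p863141 `K2LiuKindOneLineTermPackage`
(LEAD F0P6-plan (g14) BATCH #175 (1), 2026-09-04T23:54:41Z; heir of LH4-p07 (g11)'s SIG v0 16f0cb99a41124dd + census `CENSUS-K1a-SingularTermPackage.LH4p07g11.md`).
ED. 1 = THE PACKAGE FROM FOUR LETTERS (interface of record) + THE PACKAGE FROM ★ p863286's PLACE LETTERS (explicit family, (F-V) transparent).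
THEOREMS ONLY (no `def`, no `instance`, no notation, no named-fact hypothesis, no `sorry`).
-/
import Summits.HodgeConjecture.HodgeConjecture.Theorems.K2LiuKindOneLineTermPackage          -- ★ p863141 (K2Liu-p14): the K1-b♮ twin — frame vocabulary + §1 `support_of_support_on_halfPlane`
import Summits.HodgeConjecture.HodgeConjecture.Theorems.K2LiuKindOneSingularGlobalAssembler   -- ★ p863286 (LH4-p07): the place letters' currency (`IsQRationalRegularAt`, the K1 scalar of record)
import Summits.HodgeConjecture.HodgeConjecture.Theorems.K2LiuKindOneSingularScalarChangeOfSet -- ★ p863157 (LH4-p07): `sub_half_mul_scalarK1_union_eq`, `differentiableOn_finsetProd_inv_localScalarK1_mul` (the scalar at a moving set)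
import Literature.NumberTheory.Automorphic.AdelicHeightGLProofs                              -- ★ `adelicHeightGL_nonneg`
import HarnessLib

/-!
# Crux `HLiu418`, socket #41, KIND 1 — (K1a-♮) THE SINGULAR-TERM PACKAGE, ED. 1: THE TWELVE K1-a♮ LETTERS
# `∃ Eac, hEad ∧ hEac ∧ ∃ τa, hτa ∧ ∃ Na, hdeca ∧ ∃ Ca κa, 0 < Ca ∧ 0 ≤ κa ∧ hsuppa` — (§1) from FOUR LETTERS about one function, (§2) from ★ p863286's PLACE LETTERS

Cell `hodgecm-mathlib`, crux item hLiu418 = `stmt-HodgeConjecture-24832` (helper lane `--supports … --as helper`, count-neutral), route of record `HCCMUnconditional`;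
squad K2 ∕ K2Liu, road `K2_Liu`, socket #41 `sig_K2LiuSiegelEisensteinContinuation`, KIND 1, block K1-a♮ = the by-value letters
`(Eac hEad hEac τa hτa Na hdeca {Ca κa} hCa hκa hsuppa)` of ★ ED. 20 `K2LiuSiegelEisensteinContinuationTopTwentySocket.siegelEisensteinContinuation_twenty` :133–:147:
the continued `(s − ½)·`NORMALISED WHITTAKER (singular, rank-one) term of a Fourier coefficient.  Line lead K2E5-p16 (g8) (census `CENSUS-K1a-GK`, road B = the EULER ROAD);
the (K1a-1…4) organ: ★ p862643 corner transport · ★ p862724∕p862811∕p863212∕p863217 local values · ★ p862699 + ★ p863185 arch · ★ p862613 + ★ p863157 the K1 scalar of record and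
its change of set · ★ p862746 + ★ p863037 + ★ p863118 + ★ p863286 the continued Euler head ∕ faces ∕ value block ∕ global assembler.  THIS FILE is the interface those payers
type to — TWO heads, both hypothesis-first:
* §1 **`exists_kindOne_singularTermPackage_of_letters`** — THE EXACT K1-a♮ TWIN OF ★ p863141 §2 (interface of record): socket prefix as ★ p863141 MINUS `(wq, hwq)` (the singular pin
  does not read the rational Weyl presentation; = LH4-p07's SIG v0 prefix); then FOUR LETTERS about ONE function `E : Skew → ℂ → H(𝔸) → ℂ`: (hol) holomorphy on `{0 < re}`;
  (pin) the TOP's `hEac` identity `(s − ½)·((∫β)⁻¹ • W_S(νN)(f_s)(h)) = E S s h` on `{n∕2 < re s}` for rank-one `S` (bytes of ★ ED. 20 :135–:137); (dec) `τa hτa Na hdec` in the TOP's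
  shape; (supp½) `hCa hκa hsupp` — support ON `{n∕2 < re s}` ONLY.  CONCLUSION = the twelve K1-a♮ letters TOKEN FOR TOKEN (`Eac := E`; `hsuppa` on `{0 < re s}` by ★ p863141 §1
  `support_of_support_on_halfPlane`, the conclusion of a support letter being `s`-free).
* §2 **`exists_kindOne_singularTermPackage_of_placeLetters`** — (hol) + (pin) DISCHARGED from ★ p863286's by-value place letters, the tail letters `Gc hGc hGR` INTERNAL, the family
  EXPLICIT ((F-V) transparent, LH4-p11 (g10); ★ p863118's design of ONE pole-cleared scalar, moved along ★ p863157): by value (i) ONE exceptional set `T″` with the pole-cleared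
  K1 scalar of record `G` (`hG` holomorphic on `{0 < re}`, `hsc : (s − ½)·[ζ^{T″}_{L⁺}(2s) ∕ (ζ^{T″}_{L⁺}(2s+1)·L^{T″}(2s+2, ε))] = G s` on `½ < re s` — ★ p862613
  `exists_differentiableOn_sub_half_mul_scalarK1_cm`, once); (ii) per rank-one `S` and every `h` (indexed `S h`; generic index types `ι ι′ κ` as ★ p863286): the constant `c S h`, the
  shell set `D S h` with polynomials `P S h v` (`hP`), the MOVING part `Pm S h` of ★ G1's exceptional set `T″ ∪ Pm(S,h)` (`hPT`: disjoint from `T″`; line lead K2E5-p16 WORD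
  2026-09-04T23:58:14Z), the head `HT S · h`, its pure-tensor presentation over `I S h`, `T S h` (`q hq A W hsplit`), the continued letters `Ac hAc hA`, `Gn hGn hW` (`hGn` = `q_v`-rational
  regular at EVERY `s₀` of `{0 < re}`), and the TAIL IDENTITY `htail` on `{1 < re s}` with the K1 scalar AT THE MOVING SET `T″ ∪ Pm S h` — ★ p863286 §3's binders, `(S, h)`-indexed;
  (iii) (dec) + (supp½) BY VALUE about the EXPLICIT rank-one expression `c S h · (Σ_{i∈I S h} Ac S i s h · ∏_{v∈T S h} Gn S i v s h) · ((∏_{v∈Pm S h} c¹_v(s)⁻¹)·G s) · ∏_{v∈D S h} P S h v s`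
  (★ p863157: `(s − ½)·sc¹^{T″∪Pm} = (∏_{v∈Pm} c¹_v⁻¹)·G`, `‖c¹_v⁻¹‖ ≤ 16∕3` on `{0 < re}`).  CONCLUSION: `∃ Eac`, the two WITNESS equations (`Eac =` that expression on rank-one `S`,
  `= 0` off rank one) ∧ the twelve K1-a♮ letters verbatim.  Proof: the family is the `if`; `hEad` = ★ p863286's holomorphy bookkeeping (★ `differentiableOn_re_pos_of_forall_isQRationalRegularAt`)
  × ★ `differentiableOn_finsetProd_inv_localScalarK1_mul`; `hEac` on `{n∕2 < re s}` (`n = 2` read off `e`) = `htail ∘ hsplit ∘ hA ∘ hW ∘` ★ `sub_half_mul_scalarK1_union_eq`;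
  `hdeca`∕`hsuppa` from (iii) and §1's identity-theorem step.
[KudlaRallis1994, §2 (2.10)–(2.12)] [Tan1999, §3, §4 Prop. 4.8] [KudlaSweet1997, §1] [MoeglinWaldspurger1995, II.1.7, IV.1.9] [Shimura1997, §18.4 Prop. 18.14] [Conway1978, IV.3].
HONEST LABEL.  Count-neutral helper, hypothesis-first; it closes no socket by itself: `HC_CM` is proved only modulo the 7 printed citations (2 remaining named inputs:
hLiu418 = `stmt-HodgeConjecture-24832`, h413 = `stmt-HodgeConjecture-24833`) until rung 0 closes.  NOT HERE (the payers, named): the place letters' producers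
((K1a-3) local faces K2E3-p29∕LH4-p10∕LH4-p11, the tail identity's assembler K2E3-p28∕R90-C14-p02 ED. 2), the (dec)∕(supp) letters' producers (line words #6–#8: (ρ)-bricks,
★ p863212∕p863217 local values, the row-section height control).

## References
* [KudlaRallis1994] S. Kudla, S. Rallis, Ann. of Math. 140 (1994): §2 (2.10)–(2.12).   * [Tan1999] V. Tan, Canad. J. Math. 51 (1999): §3, §4 Prop. 4.8.
* [KudlaSweet1997] S. Kudla, W. J. Sweet, Israel J. Math. 98 (1997): §1.   * [MoeglinWaldspurger1995] C. Mœglin, J.-L. Waldspurger (1995): II.1.7, IV.1.9.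
* [Shimura1997] G. Shimura, CBMS 93 (1997): §18.4 Prop. 18.14.   * [Conway1978] J. B. Conway, *Functions of One Complex Variable I*: IV.3 (identity theorem).
-/

set_option autoImplicit false
-- the mandated namespace repeats the single-problem summit's segment (`HodgeConjecture.HodgeConjecture`)
set_option linter.dupNamespace false

noncomputable section

open scoped Matrix ENNReal NNReal Topology ComplexConjugate
open NumberField IsDedekindDomain MeasureTheory MeasureTheory.Measure Filter Set Function Metric
open Literature.NumberTheory.Automorphic Literature.NumberTheory.Automorphic.UnitaryGroup Literature.NumberTheory.GaloisRepresentations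
open Literature.NumberTheory.LFunctions
open Literature.NumberTheory.GelbartRogawski1991 Literature.NumberTheory.GelbartRogawski1991.GRConstruction
open Literature.NumberTheory.K2Lit.SiegelDoubled Literature.MeasureTheory.Group
open Literature.NumberTheory.Automorphic.IdeleClassGroup

namespace Summit.HodgeConjecture.HodgeConjecture.Cruxes.HLiu418.K2LiuKindOneSingularTermPackage

open K2LiuSiegelUnipotentFourierDefs K2LiuSiegelUnipotentCharacters K2LiuUnipotentCoveringWeight K2LiuSiegelFourierCoeffDelta
open K2LiuQRationalDefs (IsQRationalRegularAt)
open K2LiuBigCellContinuationPointLetters (differentiableOn_re_pos_of_forall_isQRationalRegularAt)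
open K2LiuKindOneLineTermPackage (support_of_support_on_halfPlane)
open K2LiuKindOneSingularScalarChangeOfSet (sub_half_mul_scalarK1_union_eq differentiableOn_finsetProd_inv_localScalarK1_mul)

/-! ## §1 The K1-a♮ block from four letters (interface of record) -/

open Classical in
/-- **(K1a-♮) THE SINGULAR-TERM PACKAGE FROM FOUR LETTERS** (ED. 1, interface of record; the K1-a♮ twin of ★ `exists_kindOne_lineTermPackage_of_letters`).  Socket prefix
VERBATIM (`L e dV hdV hdV0 dW hdW hdW0 lam hlam hw 𝒦 h𝒦 f hstd hcont`, the carrier `νN β hβ hβ0 hβtop K hK hβK`; no `wq hwq` — the singular pin does not read the rational Weyl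
presentation); then BY VALUE about ONE function `E`: (hol) holomorphy on `{0 < re}`; (pin) the TOP's `(s − ½)·`normalised singular Whittaker identity `= E S s h` on `{n∕2 < re s}` for
rank-one `S` (★ ED. 20 :135–:137 bytes); (dec) `τa hτa Na hdec` in the TOP's shape; (supp½) support with `(Ca, κa)` ON `{n∕2 < re s}` ONLY.  CONCLUSION = the twelve K1-a♮ letters
of ★ ED. 20 :133–:147 TOKEN FOR TOKEN (`Eac := E`; `hsuppa` on `{0 < re s}` by ★ `support_of_support_on_halfPlane`, the conclusion of a support letter being `s`-free).
[cite: KudlaRallis1994, §2 (2.10)–(2.12)] [cite: MoeglinWaldspurger1995, II.1.7, IV.1.9] [cite: Tan1999, §4 Prop. 4.8] [cite: Shimura1997, §18.4 Prop. 18.14] -/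
theorem exists_kindOne_singularTermPackage_of_letters
    (L : Type) [Field L] [NumberField L] [IsCMField L] {n : ℕ} (e : Fin 2 × Fin 1 ≃ Fin n)
    (dV : Fin 2 → L) (hdV : ∀ i, IsCMField.complexConj L (dV i) = dV i) (_hdV0 : ∀ i, dV i ≠ 0)
    (dW : Fin 1 → L) (hdW : ∀ i, IsCMField.complexConj L (dW i) = dW i) (_hdW0 : ∀ i, dW i ≠ 0)
    (lam : IdeleClassGroup L →ₜ* Circle) (_hlam : IsConjugateSymplectic L lam) (_hw : HasWeight L lam 1)
    (𝒦 : IwasawaDatum L e dV hdV dW hdW) (_h𝒦 : 𝒦.IsStd) (f : ℂ → HA L e dV hdV dW hdW → ℂ)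
    (_hstd : IsStandardSectionFamily 𝒦 (toHeckeCharacter L lam⁻¹) f) (_hcont : ∀ s, Continuous (f s))
    [MeasurableSpace (unipDelta L e dV hdV dW hdW)] [BorelSpace (unipDelta L e dV hdV dW hdW)]
    (νN : Measure (unipDelta L e dV hdV dW hdW)) [νN.IsHaarMeasure]
    (β : unipDelta L e dV hdV dW hdW → ℝ≥0∞) (_hβ : IsCoveringWeight (unipDeltaRat L e dV hdV dW hdW) β)
    (_hβ0 : ∫⁻ u, β u ∂νN ≠ 0) (_hβtop : ∫⁻ u, β u ∂νN ≠ ∞)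
    {K : Set (unipDelta L e dV hdV dW hdW)} (_hK : IsCompact K) (_hβK : ∀ u, β u ≤ K.indicator 1 u)
    -- THE FOUR LETTERS about ONE function `E`
    (E : skewMatrices ((IsCMField.complexConj L : L ≃ₐ[Fp L] L) : L →+* L) ((gramR L e dV hdV dW hdW).map (algebraMap (Fp L) L)) → ℂ → HA L e dV hdV dW hdW → ℂ)
    (hEd : ∀ S x, DifferentiableOn ℂ (fun s => E S s x) {s : ℂ | 0 < s.re})
    (hpin : ∀ S : skewMatrices ((IsCMField.complexConj L : L ≃ₐ[Fp L] L) : L →+* L) ((gramR L e dV hdV dW hdW).map (algebraMap (Fp L) L)),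
      (S : Matrix (Fin n) (Fin n) L) ≠ 0 → (S : Matrix (Fin n) (Fin n) L).det = 0 → ∀ (s : ℂ) (h : HA L e dV hdV dW hdW), (n : ℝ) / 2 < s.re →
        (s - 1 / 2) * (((∫⁻ u, β u ∂νN).toReal⁻¹ : ℝ) • whittakerDelta L e dV hdV dW hdW νN (S : Matrix (Fin n) (Fin n) L) (f s) h) = E S s h)
    (τa : skewMatrices ((IsCMField.complexConj L : L ≃ₐ[Fp L] L) : L →+* L) ((gramR L e dV hdV dW hdW).map (algebraMap (Fp L) L)) → ℝ)
    (hτa : ∀ S : skewMatrices ((IsCMField.complexConj L : L ≃ₐ[Fp L] L) : L →+* L) ((gramR L e dV hdV dW hdW).map (algebraMap (Fp L) L)),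
      ‖(fun i j => NumberField.mixedEmbedding L ((S : Matrix (Fin n) (Fin n) L) i j))‖ ≤ τa S) (Na : ℕ)
    (hdec : ∀ z : ℂ, 0 < z.re → ∃ C a c a' r : ℝ, 0 ≤ C ∧ 0 ≤ a ∧ 0 < c ∧ 0 ≤ a' ∧ 0 < r ∧ ∀ S (s : ℂ), dist s z < r → ∀ h : HA L e dV hdV dW hdW,
      ‖E S s h‖ ≤ C * adelicHeightGL (n + n) L (h : GL (Fin (n + n)) (AdeleRing (𝓞 L) L)) ^ a *
        (Real.exp (-(c * adelicHeightGL (n + n) L (h : GL (Fin (n + n)) (AdeleRing (𝓞 L) L)) ^ (-a') * τa S)) * (1 + τa S) ^ Na))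
    {Ca κa : ℝ} (hCa : 0 < Ca) (hκa : 0 ≤ κa)
    (hsupp : ∀ S (s : ℂ) (h : HA L e dV hdV dW hdW), (n : ℝ) / 2 < s.re → E S s h ≠ 0 →
      ∃ D : ℕ, 1 ≤ D ∧ (D : ℝ) ≤ Ca * adelicHeightGL (n + n) L (h : GL (Fin (n + n)) (AdeleRing (𝓞 L) L)) ^ κa ∧
        ∀ i j, IsIntegral ℤ ((D : L) * (S : Matrix (Fin n) (Fin n) L) i j)) :
    ∃ (Eac : skewMatrices ((IsCMField.complexConj L : L ≃ₐ[Fp L] L) : L →+* L) ((gramR L e dV hdV dW hdW).map (algebraMap (Fp L) L)) → ℂ → HA L e dV hdV dW hdW → ℂ),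
      (∀ S x, DifferentiableOn ℂ (fun s => Eac S s x) {s : ℂ | 0 < s.re}) ∧
      (∀ S : skewMatrices ((IsCMField.complexConj L : L ≃ₐ[Fp L] L) : L →+* L) ((gramR L e dV hdV dW hdW).map (algebraMap (Fp L) L)),
        (S : Matrix (Fin n) (Fin n) L) ≠ 0 → (S : Matrix (Fin n) (Fin n) L).det = 0 → ∀ (s : ℂ) (h : HA L e dV hdV dW hdW), (n : ℝ) / 2 < s.re →
          (s - 1 / 2) * (((∫⁻ u, β u ∂νN).toReal⁻¹ : ℝ) • whittakerDelta L e dV hdV dW hdW νN (S : Matrix (Fin n) (Fin n) L) (f s) h) = Eac S s h) ∧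
      ∃ (τa : skewMatrices ((IsCMField.complexConj L : L ≃ₐ[Fp L] L) : L →+* L) ((gramR L e dV hdV dW hdW).map (algebraMap (Fp L) L)) → ℝ),
        (∀ S : skewMatrices ((IsCMField.complexConj L : L ≃ₐ[Fp L] L) : L →+* L) ((gramR L e dV hdV dW hdW).map (algebraMap (Fp L) L)),
          ‖(fun i j => NumberField.mixedEmbedding L ((S : Matrix (Fin n) (Fin n) L) i j))‖ ≤ τa S) ∧
        ∃ Na : ℕ,
          (∀ z : ℂ, 0 < z.re → ∃ C a c a' r : ℝ, 0 ≤ C ∧ 0 ≤ a ∧ 0 < c ∧ 0 ≤ a' ∧ 0 < r ∧ ∀ S (s : ℂ), dist s z < r → ∀ h : HA L e dV hdV dW hdW,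
            ‖Eac S s h‖ ≤ C * adelicHeightGL (n + n) L (h : GL (Fin (n + n)) (AdeleRing (𝓞 L) L)) ^ a *
              (Real.exp (-(c * adelicHeightGL (n + n) L (h : GL (Fin (n + n)) (AdeleRing (𝓞 L) L)) ^ (-a') * τa S)) * (1 + τa S) ^ Na)) ∧
          ∃ Ca κa : ℝ, 0 < Ca ∧ 0 ≤ κa ∧
            (∀ S (s : ℂ) (h : HA L e dV hdV dW hdW), 0 < s.re → Eac S s h ≠ 0 →
              ∃ D : ℕ, 1 ≤ D ∧ (D : ℝ) ≤ Ca * adelicHeightGL (n + n) L (h : GL (Fin (n + n)) (AdeleRing (𝓞 L) L)) ^ κa ∧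
                ∀ i j, IsIntegral ℤ ((D : L) * (S : Matrix (Fin n) (Fin n) L) i j)) := by
  have hn0 : (0 : ℝ) ≤ (n : ℝ) / 2 := by positivity
  exact ⟨E, hEd, hpin, τa, hτa, Na, hdec, Ca, κa, hCa, hκa,
    support_of_support_on_halfPlane hEd hn0
      (P := fun S (h : HA L e dV hdV dW hdW) => ∃ D : ℕ, 1 ≤ D ∧ (D : ℝ) ≤ Ca * adelicHeightGL (n + n) L (h : GL (Fin (n + n)) (AdeleRing (𝓞 L) L)) ^ κa ∧
        ∀ i j, IsIntegral ℤ ((D : L) * (S : Matrix (Fin n) (Fin n) L) i j)) hsupp⟩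

/-! ## §2 The K1-a♮ block from ★ p863286's place letters: explicit family, pole-cleared scalar of record at a moving exceptional set -/

open Classical in
/-- **(K1a-♮) THE SINGULAR-TERM PACKAGE FROM PLACE LETTERS** ((hol) + (pin) DISCHARGED; the tail letters `Gc hGc hGR` of ★ `exists_Gc_of_placeLetters_scalarK1_cm` INTERNAL; the family
EXPLICIT, (F-V) transparent).  Socket prefix as §1; then BY VALUE: (i) ONE exceptional set `T″` with the pole-cleared K1 scalar of record `G` (`hG`, `hsc` — ★ p862613
`exists_differentiableOn_sub_half_mul_scalarK1_cm` at `T″`, ONCE); (ii) per rank-one `S` (`↑S ≠ 0`, `det ↑S = 0`) and every `h`, ★ p863286 §3's letters `(S, h)`-indexed: the constant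
`c S h`, the shell set `D S h` with polynomials `P S h v` (`hP`), the MOVING part `Pm S h` of the exceptional set (`hPT`: disjoint from `T″` — line lead K2E5-p16 WORD 23:58:14Z: ★ G1's
finite set is `T″ ∪ P(S,h)`), the head `HT S · h` with its pure-tensor presentation over `I S h`, `T S h` (`q hq A W hsplit`), the continued letters `Ac hAc hA`, `Gn hGn hW` (`hGn` =
`q_v`-rational regular at EVERY `s₀` of `{0 < re}`), and the TAIL IDENTITY on `{1 < re s}` with the K1 scalar of record AT THE MOVING SET
`(∫β)⁻¹ • W_S(νN)(f_s)(h) = c S h · HT S s h · [ζ^{T″∪Pm}_{L⁺}(2s) ∕ (ζ^{T″∪Pm}_{L⁺}(2s+1)·L^{T″∪Pm}(2s+2, ε_{L∕L⁺}))] · ∏_{v∈D S h} P S h v s` (`htail`);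
(iii) (dec) `τa hτa Na hdec` and (supp½, on `{n∕2 < re s}`) `hCa hκa hsupp` about the EXPLICIT rank-one expression
`X S s h := c S h · (Σ_{i∈I S h} Ac S i s h · ∏_{v∈T S h} Gn S i v s h) · ((∏_{v∈Pm S h} c¹_v(s)⁻¹) · G s) · ∏_{v∈D S h} P S h v s` (`c¹_v(s)⁻¹ = (1 − q_v^{−2s}) ∕ ((1 − q_v^{−(2s+1)})(1 − ε_v q_v^{−(2s+2)}))`,
★ p863157's transported continuation `(s − ½)·sc¹^{T″∪Pm} = (∏_{v∈Pm} c¹_v⁻¹)·G`).  CONCLUSION: `∃ Eac` with the two WITNESS equations (`Eac S s h = X S s h` on rank-one `S`; `= 0` off rank one —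
what BLOCK D's `hpres` reads) and the twelve K1-a♮ letters of ★ ED. 20 :133–:147 verbatim.  Proof: `Eac := if rank-one then X else 0`; `hEad` by ★ p863286's bookkeeping
(★ `differentiableOn_re_pos_of_forall_isQRationalRegularAt`, `hAc`, ★ `differentiableOn_finsetProd_inv_localScalarK1_mul hG`, `hP`); `hEac` on `{n∕2 < re s}` (`n = 2` from `e`) by
`htail`, `hsplit`, `hA`, `hW` and ★ `sub_half_mul_scalarK1_union_eq` (`hsc`, `hPT`); `hdeca` from `hdec` (off rank one `‖0‖ ≤ RHS`, ★ `adelicHeightGL_nonneg`); `hsuppa` from `hsupp` through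
★ `support_of_support_on_halfPlane`. [cite: Tan1999, §3, §4 Prop. 4.8] [cite: KudlaRallis1994, §2 (2.10)–(2.12)] [cite: KudlaSweet1997, §1] [cite: MoeglinWaldspurger1995, IV.1.9]
[cite: Shimura1997, §18.4 Prop. 18.14] -/
theorem exists_kindOne_singularTermPackage_of_placeLetters
    (L : Type) [Field L] [NumberField L] [IsCMField L] {n : ℕ} (e : Fin 2 × Fin 1 ≃ Fin n)
    (dV : Fin 2 → L) (hdV : ∀ i, IsCMField.complexConj L (dV i) = dV i) (_hdV0 : ∀ i, dV i ≠ 0)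
    (dW : Fin 1 → L) (hdW : ∀ i, IsCMField.complexConj L (dW i) = dW i) (_hdW0 : ∀ i, dW i ≠ 0)
    (lam : IdeleClassGroup L →ₜ* Circle) (_hlam : IsConjugateSymplectic L lam) (_hw : HasWeight L lam 1)
    (𝒦 : IwasawaDatum L e dV hdV dW hdW) (_h𝒦 : 𝒦.IsStd) (f : ℂ → HA L e dV hdV dW hdW → ℂ)
    (_hstd : IsStandardSectionFamily 𝒦 (toHeckeCharacter L lam⁻¹) f) (_hcont : ∀ s, Continuous (f s))
    [MeasurableSpace (unipDelta L e dV hdV dW hdW)] [BorelSpace (unipDelta L e dV hdV dW hdW)]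
    (νN : Measure (unipDelta L e dV hdV dW hdW)) [νN.IsHaarMeasure]
    (β : unipDelta L e dV hdV dW hdW → ℝ≥0∞) (_hβ : IsCoveringWeight (unipDeltaRat L e dV hdV dW hdW) β)
    (_hβ0 : ∫⁻ u, β u ∂νN ≠ 0) (_hβtop : ∫⁻ u, β u ∂νN ≠ ∞)
    {K : Set (unipDelta L e dV hdV dW hdW)} (_hK : IsCompact K) (_hβK : ∀ u, β u ≤ K.indicator 1 u)
    -- (i) ONE exceptional set `T″` and the pole-cleared K1 scalar of record BY VALUE (★ `exists_differentiableOn_sub_half_mul_scalarK1_cm` at `T″`, once)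
    (T'' : Set (HeightOneSpectrum (𝓞 ↥(maximalRealSubfield L))))
    (G : ℂ → ℂ) (hG : DifferentiableOn ℂ G {s : ℂ | 0 < s.re})
    (hsc : ∀ s : ℂ, 1 / 2 < s.re →
      (s - 1 / 2) *
        (partialStandardL T'' (fun _ => {1}) (2 * s) /
          (partialStandardL T'' (fun _ => {1}) (2 * s + 1) *
            partialStandardL T'' (fun v => {(quadraticHeckeCharCM L).valueAtUniformizer v}) (2 * s + 2))) = G s)
    -- (ii) ★ p863286 §3's place letters per rank-one `S` and every `h`: constant, shell set and polynomials, the moving part of the exceptional set, head and presentation, tail identity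
    {ι ι' κ : Type*}
    (c : skewMatrices ((IsCMField.complexConj L : L ≃ₐ[Fp L] L) : L →+* L) ((gramR L e dV hdV dW hdW).map (algebraMap (Fp L) L)) → HA L e dV hdV dW hdW → ℂ)
    (D : skewMatrices ((IsCMField.complexConj L : L ≃ₐ[Fp L] L) : L →+* L) ((gramR L e dV hdV dW hdW).map (algebraMap (Fp L) L)) → HA L e dV hdV dW hdW → Finset κ)
    (P : skewMatrices ((IsCMField.complexConj L : L ≃ₐ[Fp L] L) : L →+* L) ((gramR L e dV hdV dW hdW).map (algebraMap (Fp L) L)) → HA L e dV hdV dW hdW → κ → ℂ → ℂ)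
    (hP : ∀ S : skewMatrices ((IsCMField.complexConj L : L ≃ₐ[Fp L] L) : L →+* L) ((gramR L e dV hdV dW hdW).map (algebraMap (Fp L) L)),
      (S : Matrix (Fin n) (Fin n) L) ≠ 0 → (S : Matrix (Fin n) (Fin n) L).det = 0 → ∀ (h : HA L e dV hdV dW hdW), ∀ v ∈ D S h, DifferentiableOn ℂ (P S h v) {s : ℂ | 0 < s.re})
    (Pm : skewMatrices ((IsCMField.complexConj L : L ≃ₐ[Fp L] L) : L →+* L) ((gramR L e dV hdV dW hdW).map (algebraMap (Fp L) L)) → HA L e dV hdV dW hdW → Finset (HeightOneSpectrum (𝓞 ↥(maximalRealSubfield L))))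
    (hPT : ∀ (S : skewMatrices ((IsCMField.complexConj L : L ≃ₐ[Fp L] L) : L →+* L) ((gramR L e dV hdV dW hdW).map (algebraMap (Fp L) L))) (h : HA L e dV hdV dW hdW), ∀ v ∈ Pm S h, v ∉ T'')
    (HT : skewMatrices ((IsCMField.complexConj L : L ≃ₐ[Fp L] L) : L →+* L) ((gramR L e dV hdV dW hdW).map (algebraMap (Fp L) L)) → ℂ → HA L e dV hdV dW hdW → ℂ)
    (htail : ∀ S : skewMatrices ((IsCMField.complexConj L : L ≃ₐ[Fp L] L) : L →+* L) ((gramR L e dV hdV dW hdW).map (algebraMap (Fp L) L)),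
      (S : Matrix (Fin n) (Fin n) L) ≠ 0 → (S : Matrix (Fin n) (Fin n) L).det = 0 → ∀ (s : ℂ) (h : HA L e dV hdV dW hdW), 1 < s.re →
        ((∫⁻ u, β u ∂νN).toReal⁻¹ : ℝ) • whittakerDelta L e dV hdV dW hdW νN (S : Matrix (Fin n) (Fin n) L) (f s) h =
          c S h * HT S s h *
            (partialStandardL (T'' ∪ (↑(Pm S h) : Set (HeightOneSpectrum (𝓞 ↥(maximalRealSubfield L))))) (fun _ => {1}) (2 * s) /
              (partialStandardL (T'' ∪ (↑(Pm S h) : Set (HeightOneSpectrum (𝓞 ↥(maximalRealSubfield L))))) (fun _ => {1}) (2 * s + 1) *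
                partialStandardL (T'' ∪ (↑(Pm S h) : Set (HeightOneSpectrum (𝓞 ↥(maximalRealSubfield L))))) (fun v => {(quadraticHeckeCharCM L).valueAtUniformizer v}) (2 * s + 2))) *
            ∏ v ∈ D S h, P S h v s)
    (I : skewMatrices ((IsCMField.complexConj L : L ≃ₐ[Fp L] L) : L →+* L) ((gramR L e dV hdV dW hdW).map (algebraMap (Fp L) L)) → HA L e dV hdV dW hdW → Finset ι')
    (T : skewMatrices ((IsCMField.complexConj L : L ≃ₐ[Fp L] L) : L →+* L) ((gramR L e dV hdV dW hdW).map (algebraMap (Fp L) L)) → HA L e dV hdV dW hdW → Finset ι)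
    (q : ι → ℕ) (hq : ∀ (S : skewMatrices ((IsCMField.complexConj L : L ≃ₐ[Fp L] L) : L →+* L) ((gramR L e dV hdV dW hdW).map (algebraMap (Fp L) L))) (h : HA L e dV hdV dW hdW), ∀ v ∈ T S h, q v ≠ 0)
    (A : skewMatrices ((IsCMField.complexConj L : L ≃ₐ[Fp L] L) : L →+* L) ((gramR L e dV hdV dW hdW).map (algebraMap (Fp L) L)) → ι' → ℂ → HA L e dV hdV dW hdW → ℂ)
    (W : skewMatrices ((IsCMField.complexConj L : L ≃ₐ[Fp L] L) : L →+* L) ((gramR L e dV hdV dW hdW).map (algebraMap (Fp L) L)) → ι' → ι → ℂ → HA L e dV hdV dW hdW → ℂ)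
    (hsplit : ∀ S : skewMatrices ((IsCMField.complexConj L : L ≃ₐ[Fp L] L) : L →+* L) ((gramR L e dV hdV dW hdW).map (algebraMap (Fp L) L)),
      (S : Matrix (Fin n) (Fin n) L) ≠ 0 → (S : Matrix (Fin n) (Fin n) L).det = 0 → ∀ (s : ℂ), 1 < s.re → ∀ (h : HA L e dV hdV dW hdW),
        HT S s h = ∑ i ∈ I S h, A S i s h * ∏ v ∈ T S h, W S i v s h)
    (Ac : skewMatrices ((IsCMField.complexConj L : L ≃ₐ[Fp L] L) : L →+* L) ((gramR L e dV hdV dW hdW).map (algebraMap (Fp L) L)) → ι' → ℂ → HA L e dV hdV dW hdW → ℂ)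
    (hAc : ∀ S : skewMatrices ((IsCMField.complexConj L : L ≃ₐ[Fp L] L) : L →+* L) ((gramR L e dV hdV dW hdW).map (algebraMap (Fp L) L)),
      (S : Matrix (Fin n) (Fin n) L) ≠ 0 → (S : Matrix (Fin n) (Fin n) L).det = 0 → ∀ (h : HA L e dV hdV dW hdW), ∀ i ∈ I S h,
        DifferentiableOn ℂ (fun s => Ac S i s h) {s : ℂ | 0 < s.re})
    (hA : ∀ S : skewMatrices ((IsCMField.complexConj L : L ≃ₐ[Fp L] L) : L →+* L) ((gramR L e dV hdV dW hdW).map (algebraMap (Fp L) L)),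
      (S : Matrix (Fin n) (Fin n) L) ≠ 0 → (S : Matrix (Fin n) (Fin n) L).det = 0 → ∀ (h : HA L e dV hdV dW hdW), ∀ i ∈ I S h, ∀ s : ℂ, 1 < s.re → A S i s h = Ac S i s h)
    (Gn : skewMatrices ((IsCMField.complexConj L : L ≃ₐ[Fp L] L) : L →+* L) ((gramR L e dV hdV dW hdW).map (algebraMap (Fp L) L)) → ι' → ι → ℂ → HA L e dV hdV dW hdW → ℂ)
    (hGn : ∀ S : skewMatrices ((IsCMField.complexConj L : L ≃ₐ[Fp L] L) : L →+* L) ((gramR L e dV hdV dW hdW).map (algebraMap (Fp L) L)),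
      (S : Matrix (Fin n) (Fin n) L) ≠ 0 → (S : Matrix (Fin n) (Fin n) L).det = 0 → ∀ (h : HA L e dV hdV dW hdW), ∀ i ∈ I S h, ∀ v ∈ T S h,
        ∀ s₀ : ℂ, 0 < s₀.re → IsQRationalRegularAt (q v) s₀ (fun s => Gn S i v s h))
    (hW : ∀ S : skewMatrices ((IsCMField.complexConj L : L ≃ₐ[Fp L] L) : L →+* L) ((gramR L e dV hdV dW hdW).map (algebraMap (Fp L) L)),
      (S : Matrix (Fin n) (Fin n) L) ≠ 0 → (S : Matrix (Fin n) (Fin n) L).det = 0 → ∀ (h : HA L e dV hdV dW hdW), ∀ i ∈ I S h, ∀ v ∈ T S h,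
        ∀ s : ℂ, 1 < s.re → W S i v s h = Gn S i v s h)
    -- (iii) (dec) and (supp½) BY VALUE about the EXPLICIT rank-one expression `c S h · (Σ_i Ac · ∏_v Gn) · ((∏_{v∈Pm S h} c¹_v(s)⁻¹) · G s) · ∏_v P S h v s`
    (τa : skewMatrices ((IsCMField.complexConj L : L ≃ₐ[Fp L] L) : L →+* L) ((gramR L e dV hdV dW hdW).map (algebraMap (Fp L) L)) → ℝ)
    (hτa : ∀ S : skewMatrices ((IsCMField.complexConj L : L ≃ₐ[Fp L] L) : L →+* L) ((gramR L e dV hdV dW hdW).map (algebraMap (Fp L) L)),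
      ‖(fun i j => NumberField.mixedEmbedding L ((S : Matrix (Fin n) (Fin n) L) i j))‖ ≤ τa S) (Na : ℕ)
    (hdec : ∀ z : ℂ, 0 < z.re → ∃ C a b a' r : ℝ, 0 ≤ C ∧ 0 ≤ a ∧ 0 < b ∧ 0 ≤ a' ∧ 0 < r ∧
      ∀ (S : skewMatrices ((IsCMField.complexConj L : L ≃ₐ[Fp L] L) : L →+* L) ((gramR L e dV hdV dW hdW).map (algebraMap (Fp L) L))) (s : ℂ), dist s z < r →
      ∀ h : HA L e dV hdV dW hdW, (S : Matrix (Fin n) (Fin n) L) ≠ 0 → (S : Matrix (Fin n) (Fin n) L).det = 0 →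
      ‖c S h * (∑ i ∈ I S h, Ac S i s h * ∏ v ∈ T S h, Gn S i v s h) * ((∏ v ∈ Pm S h, ((1 - (v.residueCard : ℂ) ^ (-(2 * s))) / ((1 - (v.residueCard : ℂ) ^ (-(2 * s + 1))) * (1 - (quadraticHeckeCharCM L).valueAtUniformizer v * (v.residueCard : ℂ) ^ (-(2 * s + 2)))))) * G s) * ∏ v ∈ D S h, P S h v s‖ ≤
        C * adelicHeightGL (n + n) L (h : GL (Fin (n + n)) (AdeleRing (𝓞 L) L)) ^ a *
          (Real.exp (-(b * adelicHeightGL (n + n) L (h : GL (Fin (n + n)) (AdeleRing (𝓞 L) L)) ^ (-a') * τa S)) * (1 + τa S) ^ Na))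
    {Ca κa : ℝ} (hCa : 0 < Ca) (hκa : 0 ≤ κa)
    (hsupp : ∀ (S : skewMatrices ((IsCMField.complexConj L : L ≃ₐ[Fp L] L) : L →+* L) ((gramR L e dV hdV dW hdW).map (algebraMap (Fp L) L))) (s : ℂ) (h : HA L e dV hdV dW hdW),
      (n : ℝ) / 2 < s.re → (S : Matrix (Fin n) (Fin n) L) ≠ 0 → (S : Matrix (Fin n) (Fin n) L).det = 0 →
      c S h * (∑ i ∈ I S h, Ac S i s h * ∏ v ∈ T S h, Gn S i v s h) * ((∏ v ∈ Pm S h, ((1 - (v.residueCard : ℂ) ^ (-(2 * s))) / ((1 - (v.residueCard : ℂ) ^ (-(2 * s + 1))) * (1 - (quadraticHeckeCharCM L).valueAtUniformizer v * (v.residueCard : ℂ) ^ (-(2 * s + 2)))))) * G s) * ∏ v ∈ D S h, P S h v s ≠ 0 →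
      ∃ D : ℕ, 1 ≤ D ∧ (D : ℝ) ≤ Ca * adelicHeightGL (n + n) L (h : GL (Fin (n + n)) (AdeleRing (𝓞 L) L)) ^ κa ∧
        ∀ i j, IsIntegral ℤ ((D : L) * (S : Matrix (Fin n) (Fin n) L) i j)) :
    ∃ (Eac : skewMatrices ((IsCMField.complexConj L : L ≃ₐ[Fp L] L) : L →+* L) ((gramR L e dV hdV dW hdW).map (algebraMap (Fp L) L)) → ℂ → HA L e dV hdV dW hdW → ℂ),
      -- the WITNESS equations ((F-V) transparency)
      (∀ (S : skewMatrices ((IsCMField.complexConj L : L ≃ₐ[Fp L] L) : L →+* L) ((gramR L e dV hdV dW hdW).map (algebraMap (Fp L) L))) (s : ℂ) (h : HA L e dV hdV dW hdW),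
        (S : Matrix (Fin n) (Fin n) L) ≠ 0 → (S : Matrix (Fin n) (Fin n) L).det = 0 →
          Eac S s h = c S h * (∑ i ∈ I S h, Ac S i s h * ∏ v ∈ T S h, Gn S i v s h) * ((∏ v ∈ Pm S h, ((1 - (v.residueCard : ℂ) ^ (-(2 * s))) / ((1 - (v.residueCard : ℂ) ^ (-(2 * s + 1))) * (1 - (quadraticHeckeCharCM L).valueAtUniformizer v * (v.residueCard : ℂ) ^ (-(2 * s + 2)))))) * G s) * ∏ v ∈ D S h, P S h v s) ∧
      (∀ (S : skewMatrices ((IsCMField.complexConj L : L ≃ₐ[Fp L] L) : L →+* L) ((gramR L e dV hdV dW hdW).map (algebraMap (Fp L) L))) (s : ℂ) (h : HA L e dV hdV dW hdW),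
        ¬ ((S : Matrix (Fin n) (Fin n) L) ≠ 0 ∧ (S : Matrix (Fin n) (Fin n) L).det = 0) → Eac S s h = 0) ∧
      -- the twelve K1-a♮ letters of ★ ED. 20 :133–:147, token for token
      (∀ S x, DifferentiableOn ℂ (fun s => Eac S s x) {s : ℂ | 0 < s.re}) ∧
      (∀ S : skewMatrices ((IsCMField.complexConj L : L ≃ₐ[Fp L] L) : L →+* L) ((gramR L e dV hdV dW hdW).map (algebraMap (Fp L) L)),
        (S : Matrix (Fin n) (Fin n) L) ≠ 0 → (S : Matrix (Fin n) (Fin n) L).det = 0 → ∀ (s : ℂ) (h : HA L e dV hdV dW hdW), (n : ℝ) / 2 < s.re →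
          (s - 1 / 2) * (((∫⁻ u, β u ∂νN).toReal⁻¹ : ℝ) • whittakerDelta L e dV hdV dW hdW νN (S : Matrix (Fin n) (Fin n) L) (f s) h) = Eac S s h) ∧
      ∃ (τa : skewMatrices ((IsCMField.complexConj L : L ≃ₐ[Fp L] L) : L →+* L) ((gramR L e dV hdV dW hdW).map (algebraMap (Fp L) L)) → ℝ),
        (∀ S : skewMatrices ((IsCMField.complexConj L : L ≃ₐ[Fp L] L) : L →+* L) ((gramR L e dV hdV dW hdW).map (algebraMap (Fp L) L)),
          ‖(fun i j => NumberField.mixedEmbedding L ((S : Matrix (Fin n) (Fin n) L) i j))‖ ≤ τa S) ∧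
        ∃ Na : ℕ,
          (∀ z : ℂ, 0 < z.re → ∃ C a c a' r : ℝ, 0 ≤ C ∧ 0 ≤ a ∧ 0 < c ∧ 0 ≤ a' ∧ 0 < r ∧ ∀ S (s : ℂ), dist s z < r → ∀ h : HA L e dV hdV dW hdW,
            ‖Eac S s h‖ ≤ C * adelicHeightGL (n + n) L (h : GL (Fin (n + n)) (AdeleRing (𝓞 L) L)) ^ a *
              (Real.exp (-(c * adelicHeightGL (n + n) L (h : GL (Fin (n + n)) (AdeleRing (𝓞 L) L)) ^ (-a') * τa S)) * (1 + τa S) ^ Na)) ∧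
          ∃ Ca κa : ℝ, 0 < Ca ∧ 0 ≤ κa ∧
            (∀ S (s : ℂ) (h : HA L e dV hdV dW hdW), 0 < s.re → Eac S s h ≠ 0 →
              ∃ D : ℕ, 1 ≤ D ∧ (D : ℝ) ≤ Ca * adelicHeightGL (n + n) L (h : GL (Fin (n + n)) (AdeleRing (𝓞 L) L)) ^ κa ∧
                ∀ i j, IsIntegral ℤ ((D : L) * (S : Matrix (Fin n) (Fin n) L) i j)) := by
  -- `n = 2` from the doubling datum, so `{n ∕ 2 < re s} = {1 < re s}` and `0 ≤ n ∕ 2`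
  have hn : n = 2 := by simpa using (Fintype.card_congr e).symm
  have hn1 : (n : ℝ) / 2 = 1 := by rw [hn]; norm_num
  have hn0 : (0 : ℝ) ≤ (n : ℝ) / 2 := by positivity
  -- `ε_{L∕L⁺}` is unitary (finite order): the hypothesis of ★ p863157's change-of-set letters
  have hε : (quadraticHeckeCharCM L).IsUnitary := (Literature.RepresentationTheory.HarrisKudlaSweet1996.isFiniteOrder_quadraticHeckeCharCM (L := L)).isUnitary
  -- the EXPLICIT family, with its two witness equations
  obtain ⟨Eac, hw, hw0⟩ : ∃ Eac : skewMatrices ((IsCMField.complexConj L : L ≃ₐ[Fp L] L) : L →+* L) ((gramR L e dV hdV dW hdW).map (algebraMap (Fp L) L)) →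
      ℂ → HA L e dV hdV dW hdW → ℂ,
      (∀ (S : skewMatrices ((IsCMField.complexConj L : L ≃ₐ[Fp L] L) : L →+* L) ((gramR L e dV hdV dW hdW).map (algebraMap (Fp L) L))) (s : ℂ) (h : HA L e dV hdV dW hdW),
        (S : Matrix (Fin n) (Fin n) L) ≠ 0 → (S : Matrix (Fin n) (Fin n) L).det = 0 →
          Eac S s h = c S h * (∑ i ∈ I S h, Ac S i s h * ∏ v ∈ T S h, Gn S i v s h) * ((∏ v ∈ Pm S h, ((1 - (v.residueCard : ℂ) ^ (-(2 * s))) / ((1 - (v.residueCard : ℂ) ^ (-(2 * s + 1))) * (1 - (quadraticHeckeCharCM L).valueAtUniformizer v * (v.residueCard : ℂ) ^ (-(2 * s + 2)))))) * G s) * ∏ v ∈ D S h, P S h v s) ∧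
      (∀ (S : skewMatrices ((IsCMField.complexConj L : L ≃ₐ[Fp L] L) : L →+* L) ((gramR L e dV hdV dW hdW).map (algebraMap (Fp L) L))) (s : ℂ) (h : HA L e dV hdV dW hdW),
        ¬ ((S : Matrix (Fin n) (Fin n) L) ≠ 0 ∧ (S : Matrix (Fin n) (Fin n) L).det = 0) → Eac S s h = 0) :=
    ⟨fun S s h => if ((S : Matrix (Fin n) (Fin n) L) ≠ 0 ∧ (S : Matrix (Fin n) (Fin n) L).det = 0) then
        c S h * (∑ i ∈ I S h, Ac S i s h * ∏ v ∈ T S h, Gn S i v s h) * ((∏ v ∈ Pm S h, ((1 - (v.residueCard : ℂ) ^ (-(2 * s))) / ((1 - (v.residueCard : ℂ) ^ (-(2 * s + 1))) * (1 - (quadraticHeckeCharCM L).valueAtUniformizer v * (v.residueCard : ℂ) ^ (-(2 * s + 2)))))) * G s) * ∏ v ∈ D S h, P S h v s else 0,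
      fun S s h hS0 hSd => if_pos (And.intro hS0 hSd), fun S s h hS => if_neg hS⟩
  -- `hEad`: ★ p863286's holomorphy bookkeeping on rank-one `S` (+ ★ p863157 for the transported scalar), the constant `0` off rank one
  have hEad : ∀ S (x : HA L e dV hdV dW hdW), DifferentiableOn ℂ (fun s => Eac S s x) {s : ℂ | 0 < s.re} := by
    intro S x
    by_cases hS : (S : Matrix (Fin n) (Fin n) L) ≠ 0 ∧ (S : Matrix (Fin n) (Fin n) L).det = 0
    · have hF : DifferentiableOn ℂ (fun s => ∑ i ∈ I S x, Ac S i s x * ∏ v ∈ T S x, Gn S i v s x) {s : ℂ | 0 < s.re} :=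
        DifferentiableOn.fun_sum fun i hi => (hAc S hS.1 hS.2 x i hi).mul (DifferentiableOn.fun_finsetProd fun v hv =>
          differentiableOn_re_pos_of_forall_isQRationalRegularAt (hq S x v hv) fun s₀ hs₀ => hGn S hS.1 hS.2 x i hi v hv s₀ hs₀)
      have hSG : DifferentiableOn ℂ (fun s : ℂ => (∏ v ∈ Pm S x, ((1 - (v.residueCard : ℂ) ^ (-(2 * s))) / ((1 - (v.residueCard : ℂ) ^ (-(2 * s + 1))) * (1 - (quadraticHeckeCharCM L).valueAtUniformizer v * (v.residueCard : ℂ) ^ (-(2 * s + 2)))))) * G s) {s : ℂ | 0 < s.re} :=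
        differentiableOn_finsetProd_inv_localScalarK1_mul hε (Pm S x) hG
      have h1 : DifferentiableOn ℂ (fun s => c S x * (∑ i ∈ I S x, Ac S i s x * ∏ v ∈ T S x, Gn S i v s x) * ((∏ v ∈ Pm S x, ((1 - (v.residueCard : ℂ) ^ (-(2 * s))) / ((1 - (v.residueCard : ℂ) ^ (-(2 * s + 1))) * (1 - (quadraticHeckeCharCM L).valueAtUniformizer v * (v.residueCard : ℂ) ^ (-(2 * s + 2)))))) * G s) * ∏ v ∈ D S x, P S x v s)
          {s : ℂ | 0 < s.re} :=
        (((differentiableOn_const (c S x)).mul hF).mul hSG).mul (DifferentiableOn.fun_finsetProd (hP S hS.1 hS.2 x))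
      exact h1.congr fun s _ => hw S s x hS.1 hS.2
    · exact (differentiableOn_const (0 : ℂ)).congr fun s _ => hw0 S s x hS
  -- `hEac` on `{n ∕ 2 < re s}`: tail identity, head presentation, continued letters, and ★ `sub_half_mul_scalarK1_union_eq` (`(s − ½)·sc¹^{T″∪Pm} = (∏ c¹_v⁻¹)·G`)
  have hEac : ∀ S : skewMatrices ((IsCMField.complexConj L : L ≃ₐ[Fp L] L) : L →+* L) ((gramR L e dV hdV dW hdW).map (algebraMap (Fp L) L)),
      (S : Matrix (Fin n) (Fin n) L) ≠ 0 → (S : Matrix (Fin n) (Fin n) L).det = 0 → ∀ (s : ℂ) (h : HA L e dV hdV dW hdW), (n : ℝ) / 2 < s.re →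
        (s - 1 / 2) * (((∫⁻ u, β u ∂νN).toReal⁻¹ : ℝ) • whittakerDelta L e dV hdV dW hdW νN (S : Matrix (Fin n) (Fin n) L) (f s) h) = Eac S s h := by
    intro S hS0 hSd s h hs
    rw [hn1] at hs
    have hs' : 1 / 2 < s.re := by linarith
    have hsum : ∑ i ∈ I S h, A S i s h * ∏ v ∈ T S h, W S i v s h = ∑ i ∈ I S h, Ac S i s h * ∏ v ∈ T S h, Gn S i v s h :=
      Finset.sum_congr rfl fun i hi => by
        rw [hA S hS0 hSd h i hi s hs]
        exact congrArg _ (Finset.prod_congr rfl fun v hv => hW S hS0 hSd h i hi v hv s hs)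
    rw [hw S s h hS0 hSd, htail S hS0 hSd s h hs, hsplit S hS0 hSd s hs h, hsum,
      ← sub_half_mul_scalarK1_union_eq hε T'' (Pm S h) (hPT S h) hsc hs']
    ring
  -- `hdeca`: the (dec) letter on rank-one `S`; `‖0‖ ≤ RHS` off rank one
  have hdeca : ∀ z : ℂ, 0 < z.re → ∃ C a c a' r : ℝ, 0 ≤ C ∧ 0 ≤ a ∧ 0 < c ∧ 0 ≤ a' ∧ 0 < r ∧
      ∀ (S : skewMatrices ((IsCMField.complexConj L : L ≃ₐ[Fp L] L) : L →+* L) ((gramR L e dV hdV dW hdW).map (algebraMap (Fp L) L))) (s : ℂ), dist s z < r →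
      ∀ h : HA L e dV hdV dW hdW,
      ‖Eac S s h‖ ≤ C * adelicHeightGL (n + n) L (h : GL (Fin (n + n)) (AdeleRing (𝓞 L) L)) ^ a *
        (Real.exp (-(c * adelicHeightGL (n + n) L (h : GL (Fin (n + n)) (AdeleRing (𝓞 L) L)) ^ (-a') * τa S)) * (1 + τa S) ^ Na) := by
    intro z hz
    obtain ⟨C, a, b, a', r, hC, ha, hb, ha', hr, hbd⟩ := hdec z hz
    refine ⟨C, a, b, a', r, hC, ha, hb, ha', hr, fun S s hs h => ?_⟩
    by_cases hS : (S : Matrix (Fin n) (Fin n) L) ≠ 0 ∧ (S : Matrix (Fin n) (Fin n) L).det = 0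
    · rw [hw S s h hS.1 hS.2]
      exact hbd S s hs h hS.1 hS.2
    · rw [hw0 S s h hS, norm_zero]
      have hτ0 : 0 ≤ 1 + τa S := by
        linarith [hτa S, norm_nonneg (fun i j => NumberField.mixedEmbedding L ((S : Matrix (Fin n) (Fin n) L) i j))]
      exact mul_nonneg (mul_nonneg hC (Real.rpow_nonneg (adelicHeightGL_nonneg (h : GL (Fin (n + n)) (AdeleRing (𝓞 L) L))) a))
        (mul_nonneg (Real.exp_pos _).le (pow_nonneg hτ0 Na))
  -- `hsuppa`: the (supp½) letter on `{n ∕ 2 < re s}` for the family, then ★ `support_of_support_on_halfPlane`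
  have hsupp' : ∀ (S : skewMatrices ((IsCMField.complexConj L : L ≃ₐ[Fp L] L) : L →+* L) ((gramR L e dV hdV dW hdW).map (algebraMap (Fp L) L))) (s : ℂ)
      (h : HA L e dV hdV dW hdW), (n : ℝ) / 2 < s.re → Eac S s h ≠ 0 →
      ∃ D : ℕ, 1 ≤ D ∧ (D : ℝ) ≤ Ca * adelicHeightGL (n + n) L (h : GL (Fin (n + n)) (AdeleRing (𝓞 L) L)) ^ κa ∧
        ∀ i j, IsIntegral ℤ ((D : L) * (S : Matrix (Fin n) (Fin n) L) i j) := by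
    intro S s h hs hne
    by_cases hS : (S : Matrix (Fin n) (Fin n) L) ≠ 0 ∧ (S : Matrix (Fin n) (Fin n) L).det = 0
    · rw [hw S s h hS.1 hS.2] at hne
      exact hsupp S s h hs hS.1 hS.2 hne
    · exact absurd (hw0 S s h hS) hne
  exact ⟨Eac, hw, hw0, hEad, hEac, τa, hτa, Na, hdeca, Ca, κa, hCa, hκa,
    support_of_support_on_halfPlane hEad hn0
      (P := fun S (h : HA L e dV hdV dW hdW) => ∃ D : ℕ, 1 ≤ D ∧ (D : ℝ) ≤ Ca * adelicHeightGL (n + n) L (h : GL (Fin (n + n)) (AdeleRing (𝓞 L) L)) ^ κa ∧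
        ∀ i j, IsIntegral ℤ ((D : L) * (S : Matrix (Fin n) (Fin n) L) i j)) hsupp'⟩

end Summit.HodgeConjecture.HodgeConjecture.Cruxes.HLiu418.K2LiuKindOneSingularTermPackage

end
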